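import Summits.RiemannHypothesis.RiemannHypothesis.Theorems.PfPersistenceBoxVertices
import Summits.RiemannHypothesis.RiemannHypothesis.Theorems.PfPersistenceInWindowMirror
import HarnessLib

/-!
# F7 box certificates — the kernel side of a `rhpf.f7-exhaust/1` NO-FAKE-CERTIFIED verdict

pub-rhpf cand-3 g7, staffing slot S4 item (d) (lead 14:34:57Z); mechanism/rigidity campaign; **no RH claims**.
RH-free: nothing here mentions `ζ`, RH, or a window of record; every statement is finite linear algebra.

An F7 cell of the verifier seat fake-7b (`HOME/pub-rhpf-fake-7b/CERTIFICATE-F7.md` §3–§3b, solver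
`code/kit_verify/exhaust.py`, output schema `rhpf.f7-exhaust/1`) is, per sector `S ∈ {even, odd}`, a matrix family
`Q_S(v) = F_S + Σ_j W_j^S(v_j)` over the FREE VARIABLES `j` (the integer Hecke data of the free primes), each of `mode`
`linear` (the window sees the prime only through atoms affine in the datum: `W_j(s) = A_j + s • B_j`, CORNERED at the two
endpoints of its `legal_range`) or `enum` (ENUMERATED over its whole `options` list). The verifier certifies, at every LEAF
(corner × option assignment) and sector, a lower bound `lb > 0` of `λ_min` (ball `LDLᵀ` + Weyl, or a Gram majorant for a whole
subtree, or engine A), and reports `min_certified_lb`. THIS FILE is the implication the verdict relies on, as theorems: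

* §1 `pencil_form_ge_of_vertexMargins` / `pencil_bottomRayleigh_ge_of_vertices` — per-vertex margins `lb ε` with
  `c ≤ lb ε` give `c·gᵀg ≤ gᵀQ(t)g`, i.e. `c ≤ ε₁(Q(t))`, on the whole box (corollaries of `pencil_form_ge_of_vertices`,
  BoxVertices ddfcc2ac2ea8);
* §2 `cellMatrix` / `IsLeaf` / `IsAdmissible` = the JSON shape verbatim (cornered AND enumerated variables), and
  `cell_form_ge_of_leaves`, `cell_bottomRayleigh_ge_of_leaves`, `cell_bottomRayleigh_pos_of_leaves`: margins at the leaves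
  ⇒ the same margin at every ADMISSIBLE assignment (cornered variables anywhere in their range — in particular at every
  integer — enumerated ones at an option); `…_intCast` for integer assignments;
* §3 the `K = 2` box spelled out with four named corners (`box2_form_ge_of_corners`, `box2_bottomRayleigh_ge_of_corners`),
  the shape of the smallest non-trivial cells (two cornered primes, four leaves).
* §4 `cell_bottomRayleigh_pos_of_leaves_pos`: positivity at every leaf ALONE suffices (the leaf set is finite,
  `isLeaf_finite`), so a verdict "every leaf certified `λ_min > 0`" needs no uniform margin in the JSON.
* §5 the PRUNE step `cell_form_ge_minorant` / `cell_bottomRayleigh_ge_minorant`: a form-minorant `L j ⪯ W j (·)` at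
  every leaf value of every variable gives `F + Σ L j ⪯ cellMatrix F W v` at every admissible `v` (JSON:
  `pruned_subtrees` — the subtree bound `P + Σ_{j ≥ i}(Cref_j − A_j)` certified PD certifies every completion).

DICTIONARY (JSON key ↦ Lean): `fixed_atoms` + template-forced atoms ↦ `F`; `free_variables[j].mode` ↦ `lin j`;
`.legal_range` ↦ `l j, u j`; `.options` ↦ `opts j` (enum) / `{l j, u j}` (linear); the affine law of a linear variable ↦
`hW : W j s = A j + s • B j`; a leaf's certified `lb` ↦ the hypothesis `lb v ≤ bottomRayleigh (cellMatrix F W v)`;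
`min_certified_lb` ↦ `c`; verdict NO-FAKE-CERTIFIED ↦ `cell_bottomRayleigh_pos_of_leaves` (`0 < c ≤ ε₁` at every admissible
assignment). What is NOT here: that the verifier's balls contain the true matrices (DATA-cert, the verifier's job), and any
statement about other windows. Labels: every theorem PROVED (kernel); no DATA.
-/

set_option linter.dupNamespace false  -- the mandated namespace repeats `RiemannHypothesis`

namespace Summit.RiemannHypothesis.RiemannHypothesis.Theorems.PfPersistence

open Finset Matrix

/-! ## §1 Per-vertex margins on a box -/

/-- PROVED: per-vertex margins `lb ε` (one certified bound per corner) with `c ≤ lb ε` for all `ε` give the margin `c` on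
the whole box, in form language. [folklore] -/
theorem pencil_form_ge_of_vertexMargins {n m : ℕ} (Q₀ : Matrix (Fin n) (Fin n) ℝ)
    (V : Fin m → Matrix (Fin n) (Fin n) ℝ) {l u : Fin m → ℝ} (lb : (Fin m → Bool) → ℝ) {c : ℝ} (hc : ∀ ε, c ≤ lb ε)
    (hv : ∀ (ε : Fin m → Bool) (g : Fin n → ℝ), lb ε * (g ⬝ᵥ g) ≤ g ⬝ᵥ (matrixPencil Q₀ V (boxVertex l u ε) *ᵥ g))
    (t : Fin m → ℝ) (ht : ∀ j, l j ≤ t j ∧ t j ≤ u j) (g : Fin n → ℝ) :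
    c * (g ⬝ᵥ g) ≤ g ⬝ᵥ (matrixPencil Q₀ V t *ᵥ g) :=
  pencil_form_ge_of_vertices Q₀ V c
    (fun ε g => (mul_le_mul_of_nonneg_right (hc ε) (dotProduct_self_nonneg_real g)).trans (hv ε g)) t ht g

/-- PROVED: `c·gᵀg ≤ gᵀMg` for all `g` iff-direction used here: it gives `c ≤ ε₁(M)` (positive dimension). [folklore] -/
theorem le_bottomRayleigh_of_form_ge {N : ℕ} (M : Matrix (Fin (N + 1)) (Fin (N + 1)) ℝ) {c : ℝ}
    (h : ∀ g : Fin (N + 1) → ℝ, c * (g ⬝ᵥ g) ≤ g ⬝ᵥ (M *ᵥ g)) : c ≤ bottomRayleigh M :=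
  le_bottomRayleigh_of_forall M fun g hg =>
    (le_div_iff₀ (lt_of_le_of_ne (dotProduct_self_nonneg_real g)
      fun h0 => hg (dotProduct_self_eq_zero.1 h0.symm))).2 (h g)

/-- PROVED (`ε₁` language): certified `lb ε ≤ ε₁(Q(vertex ε))` at every corner and `c ≤ lb ε` give `c ≤ ε₁(Q(t))` on
the whole box. [folklore] -/
theorem pencil_bottomRayleigh_ge_of_vertices {N m : ℕ} (Q₀ : Matrix (Fin (N + 1)) (Fin (N + 1)) ℝ)
    (V : Fin m → Matrix (Fin (N + 1)) (Fin (N + 1)) ℝ) {l u : Fin m → ℝ} (lb : (Fin m → Bool) → ℝ) {c : ℝ}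
    (hc : ∀ ε, c ≤ lb ε) (hv : ∀ ε : Fin m → Bool, lb ε ≤ bottomRayleigh (matrixPencil Q₀ V (boxVertex l u ε)))
    (t : Fin m → ℝ) (ht : ∀ j, l j ≤ t j ∧ t j ≤ u j) : c ≤ bottomRayleigh (matrixPencil Q₀ V t) :=
  le_bottomRayleigh_of_form_ge _ fun g => pencil_form_ge_of_vertexMargins Q₀ V lb hc
    (fun ε g => (mul_le_mul_of_nonneg_right (hv ε) (dotProduct_self_nonneg_real g)).trans
      (bottomRayleigh_mul_le_form _ g)) t ht g

/-! ## §2 The exhaust cell: cornered and enumerated variables (`rhpf.f7-exhaust/1`) -/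

/-- The matrix of an exhaust cell at an assignment `v` of its free variables: the fixed part `F` plus the contribution
`W j (v j)` of each free variable. -/
def cellMatrix {n m : ℕ} (F : Matrix (Fin n) (Fin n) ℝ) (W : Fin m → ℝ → Matrix (Fin n) (Fin n) ℝ) (v : Fin m → ℝ) :
    Matrix (Fin n) (Fin n) ℝ :=
  F + ∑ j, W j (v j)

/-- LEAVES (what the verifier certifies): a cornered variable (`lin j = true`) at an endpoint of `[l j, u j]`, an
enumerated one (`lin j = false`) at any of its options. -/
def IsLeaf {m : ℕ} (lin : Fin m → Bool) (l u : Fin m → ℝ) (opts : Fin m → Finset ℝ) (v : Fin m → ℝ) : Prop :=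
  ∀ j, if lin j then v j = l j ∨ v j = u j else v j ∈ opts j

/-- ADMISSIBLE assignments (what the verdict is about): a cornered variable anywhere in `[l j, u j]` (in particular at
every integer of its legal range), an enumerated one at any of its options. -/
def IsAdmissible {m : ℕ} (lin : Fin m → Bool) (l u : Fin m → ℝ) (opts : Fin m → Finset ℝ) (v : Fin m → ℝ) : Prop :=
  ∀ j, if lin j then l j ≤ v j ∧ v j ≤ u j else v j ∈ opts j

/-- PROVED: a leaf is admissible (needs `l j ≤ u j` on the cornered variables). [folklore] -/
theorem IsLeaf.isAdmissible {m : ℕ} {lin : Fin m → Bool} {l u : Fin m → ℝ} {opts : Fin m → Finset ℝ} {v : Fin m → ℝ}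
    (hv : IsLeaf lin l u opts v) (hlu : ∀ j, lin j = true → l j ≤ u j) : IsAdmissible lin l u opts v := by
  intro j
  have h := hv j
  cases hj : lin j
  · simpa [hj] using h
  · simp only [hj, if_true] at h ⊢
    rcases h with h | h
    · exact ⟨h.ge, h ▸ hlu j hj⟩
    · exact ⟨h ▸ hlu j hj, h.le⟩

/-- **PROVED — THE CELL CERTIFICATE LEMMA (forms):** if every cornered variable enters affinely
(`W j s = A j + s • B j`) and the margin `c` holds at every LEAF, then `c` holds at every ADMISSIBLE assignment.
(Freeze the enumerated variables at the assignment's options; what remains is a matrix pencil in the cornered variables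
whose box vertices are leaves; apply `pencil_form_ge_of_vertices`.) [folklore] -/
theorem cell_form_ge_of_leaves {n m : ℕ} (F : Matrix (Fin n) (Fin n) ℝ) (W : Fin m → ℝ → Matrix (Fin n) (Fin n) ℝ)
    (lin : Fin m → Bool) (A B : Fin m → Matrix (Fin n) (Fin n) ℝ) (hW : ∀ j, lin j = true → ∀ s, W j s = A j + s • B j)
    {l u : Fin m → ℝ} {opts : Fin m → Finset ℝ} {c : ℝ}
    (hleaf : ∀ v, IsLeaf lin l u opts v → ∀ g : Fin n → ℝ, c * (g ⬝ᵥ g) ≤ g ⬝ᵥ (cellMatrix F W v *ᵥ g))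
    (v : Fin m → ℝ) (hv : IsAdmissible lin l u opts v) (g : Fin n → ℝ) :
    c * (g ⬝ᵥ g) ≤ g ⬝ᵥ (cellMatrix F W v *ᵥ g) := by
  -- the pencil in the cornered variables, enumerated ones frozen at `v`
  set Q₀ : Matrix (Fin n) (Fin n) ℝ := F + ∑ j, (if lin j then A j else W j (v j)) with hQ₀
  set B' : Fin m → Matrix (Fin n) (Fin n) ℝ := fun j => if lin j then B j else 0 with hB'
  have key : ∀ t : Fin m → ℝ, matrixPencil Q₀ B' t = cellMatrix F W (fun j => if lin j then t j else v j) := by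
    intro t
    have hj : ∀ j, W j (if lin j then t j else v j) = (if lin j then A j else W j (v j)) + t j • B' j := by
      intro j
      cases h : lin j
      · simp [hB', h]
      · simp [hB', h, hW j h]
    simp only [matrixPencil, cellMatrix, hj, Finset.sum_add_distrib, hQ₀, add_assoc]
  -- box: the legal range on cornered variables, the degenerate interval `[v j, v j]` on enumerated ones
  set l' : Fin m → ℝ := fun j => if lin j then l j else v j with hl'
  set u' : Fin m → ℝ := fun j => if lin j then u j else v j with hu'
  have ht : ∀ j, l' j ≤ v j ∧ v j ≤ u' j := by
    intro j
    have h := hv j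
    cases hj : lin j
    · simp [hl', hu', hj]
    · simp only [hj, if_true] at h
      simpa [hl', hu', hj] using h
  have hvert : ∀ (ε : Fin m → Bool) (g : Fin n → ℝ), c * (g ⬝ᵥ g) ≤ g ⬝ᵥ (matrixPencil Q₀ B' (boxVertex l' u' ε) *ᵥ g) := by
    intro ε g
    rw [key]
    refine hleaf _ (fun j => ?_) g
    have h := hv j
    cases hj : lin j
    · simpa [hj] using h
    · cases hε : ε j <;> simp [boxVertex, hl', hu', hj, hε]
  have main := pencil_form_ge_of_vertices Q₀ B' c hvert v ht g
  rw [key] at main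
  convert main using 4
  funext j
  cases lin j <;> rfl

/-- PROVED (`ε₁` language): certified `lb v ≤ ε₁(Q(v))` at every leaf `v` and `c ≤ lb v` give `c ≤ ε₁(Q(v))` at every
admissible assignment — the implication a NO-FAKE-CERTIFIED verdict with `min_certified_lb = c` relies on. [folklore] -/
theorem cell_bottomRayleigh_ge_of_leaves {N m : ℕ} (F : Matrix (Fin (N + 1)) (Fin (N + 1)) ℝ)
    (W : Fin m → ℝ → Matrix (Fin (N + 1)) (Fin (N + 1)) ℝ) (lin : Fin m → Bool)
    (A B : Fin m → Matrix (Fin (N + 1)) (Fin (N + 1)) ℝ) (hW : ∀ j, lin j = true → ∀ s, W j s = A j + s • B j)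
    {l u : Fin m → ℝ} {opts : Fin m → Finset ℝ} (lb : (Fin m → ℝ) → ℝ) {c : ℝ}
    (hc : ∀ v, IsLeaf lin l u opts v → c ≤ lb v)
    (hleaf : ∀ v, IsLeaf lin l u opts v → lb v ≤ bottomRayleigh (cellMatrix F W v))
    (v : Fin m → ℝ) (hv : IsAdmissible lin l u opts v) : c ≤ bottomRayleigh (cellMatrix F W v) :=
  le_bottomRayleigh_of_form_ge _ fun g => cell_form_ge_of_leaves F W lin A B hW
    (fun w hw g => (mul_le_mul_of_nonneg_right ((hc w hw).trans (hleaf w hw)) (dotProduct_self_nonneg_real g)).trans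
      (bottomRayleigh_mul_le_form _ g)) v hv g

/-- **PROVED — NO-FAKE-CERTIFIED, kernel reading:** a positive certified margin at every leaf makes `ε₁ > 0` at every
admissible assignment of the free variables (no locally-honest completion inside the cell is negative). [folklore] -/
theorem cell_bottomRayleigh_pos_of_leaves {N m : ℕ} (F : Matrix (Fin (N + 1)) (Fin (N + 1)) ℝ)
    (W : Fin m → ℝ → Matrix (Fin (N + 1)) (Fin (N + 1)) ℝ) (lin : Fin m → Bool)
    (A B : Fin m → Matrix (Fin (N + 1)) (Fin (N + 1)) ℝ) (hW : ∀ j, lin j = true → ∀ s, W j s = A j + s • B j)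
    {l u : Fin m → ℝ} {opts : Fin m → Finset ℝ} (lb : (Fin m → ℝ) → ℝ) {c : ℝ} (hc0 : 0 < c)
    (hc : ∀ v, IsLeaf lin l u opts v → c ≤ lb v)
    (hleaf : ∀ v, IsLeaf lin l u opts v → lb v ≤ bottomRayleigh (cellMatrix F W v))
    (v : Fin m → ℝ) (hv : IsAdmissible lin l u opts v) : 0 < bottomRayleigh (cellMatrix F W v) :=
  hc0.trans_le (cell_bottomRayleigh_ge_of_leaves F W lin A B hW lb hc hleaf v hv)

/-- PROVED (integer assignments, the arithmetic reading: Hecke data are integers in the legal range): the margin holds at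
every integer assignment `z` with `lI j ≤ z j ≤ uI j` on cornered variables and `z j` an option on enumerated ones.
[folklore] -/
theorem cell_bottomRayleigh_ge_of_leaves_intCast {N m : ℕ} (F : Matrix (Fin (N + 1)) (Fin (N + 1)) ℝ)
    (W : Fin m → ℝ → Matrix (Fin (N + 1)) (Fin (N + 1)) ℝ) (lin : Fin m → Bool)
    (A B : Fin m → Matrix (Fin (N + 1)) (Fin (N + 1)) ℝ) (hW : ∀ j, lin j = true → ∀ s, W j s = A j + s • B j)
    {lI uI : Fin m → ℤ} {opts : Fin m → Finset ℝ} (lb : (Fin m → ℝ) → ℝ) {c : ℝ}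
    (hc : ∀ v, IsLeaf lin (fun j => (lI j : ℝ)) (fun j => (uI j : ℝ)) opts v → c ≤ lb v)
    (hleaf : ∀ v, IsLeaf lin (fun j => (lI j : ℝ)) (fun j => (uI j : ℝ)) opts v → lb v ≤ bottomRayleigh (cellMatrix F W v))
    (z : Fin m → ℤ) (hz : ∀ j, if lin j then lI j ≤ z j ∧ z j ≤ uI j else ((z j : ℤ) : ℝ) ∈ opts j) :
    c ≤ bottomRayleigh (cellMatrix F W fun j => (z j : ℝ)) := by
  refine cell_bottomRayleigh_ge_of_leaves F W lin A B hW lb hc hleaf _ fun j => ?_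
  have h := hz j
  cases hj : lin j
  · simpa [hj] using h
  · simp only [hj, if_true] at h ⊢
    exact ⟨Int.cast_le.2 h.1, Int.cast_le.2 h.2⟩

/-! ## §3 The `K = 2` box, corners named (two cornered primes, four leaves) -/

/-- **PROVED — `K = 2` BOX CERTIFICATE (forms):** margins `m₀₀, m₀₁, m₁₀, m₁₁` at the four corners of
`[l₀, u₀] × [l₁, u₁]` for `Q(t₀, t₁) = Q₀ + t₀ • V₀ + t₁ • V₁` give the margin `min` of the four on the whole box.
(Two applications of `affine_nonneg_between`; the `m = 2` instance of §1.) [folklore] -/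
theorem box2_form_ge_of_corners {n : ℕ} (Q₀ V₀ V₁ : Matrix (Fin n) (Fin n) ℝ) {l₀ u₀ l₁ u₁ m₀₀ m₀₁ m₁₀ m₁₁ : ℝ}
    (h₀₀ : ∀ g : Fin n → ℝ, m₀₀ * (g ⬝ᵥ g) ≤ g ⬝ᵥ ((Q₀ + l₀ • V₀ + l₁ • V₁) *ᵥ g))
    (h₀₁ : ∀ g : Fin n → ℝ, m₀₁ * (g ⬝ᵥ g) ≤ g ⬝ᵥ ((Q₀ + l₀ • V₀ + u₁ • V₁) *ᵥ g))
    (h₁₀ : ∀ g : Fin n → ℝ, m₁₀ * (g ⬝ᵥ g) ≤ g ⬝ᵥ ((Q₀ + u₀ • V₀ + l₁ • V₁) *ᵥ g))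
    (h₁₁ : ∀ g : Fin n → ℝ, m₁₁ * (g ⬝ᵥ g) ≤ g ⬝ᵥ ((Q₀ + u₀ • V₀ + u₁ • V₁) *ᵥ g))
    {t₀ t₁ : ℝ} (ht₀ : l₀ ≤ t₀ ∧ t₀ ≤ u₀) (ht₁ : l₁ ≤ t₁ ∧ t₁ ≤ u₁) (g : Fin n → ℝ) :
    min (min m₀₀ m₀₁) (min m₁₀ m₁₁) * (g ⬝ᵥ g) ≤ g ⬝ᵥ ((Q₀ + t₀ • V₀ + t₁ • V₁) *ᵥ g) := by
  have expand : ∀ s₀ s₁ : ℝ, g ⬝ᵥ ((Q₀ + s₀ • V₀ + s₁ • V₁) *ᵥ g) =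
      g ⬝ᵥ (Q₀ *ᵥ g) + g ⬝ᵥ (V₀ *ᵥ g) * s₀ + g ⬝ᵥ (V₁ *ᵥ g) * s₁ := by
    intro s₀ s₁
    simp only [Matrix.add_mulVec, Matrix.smul_mulVec, dotProduct_add, dotProduct_smul, smul_eq_mul]
    ring
  set c := min (min m₀₀ m₀₁) (min m₁₀ m₁₁) with hc
  have hc₀₀ : c ≤ m₀₀ := (min_le_left _ _).trans (min_le_left _ _)
  have hc₀₁ : c ≤ m₀₁ := (min_le_left _ _).trans (min_le_right _ _)
  have hc₁₀ : c ≤ m₁₀ := (min_le_right _ _).trans (min_le_left _ _)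
  have hc₁₁ : c ≤ m₁₁ := (min_le_right _ _).trans (min_le_right _ _)
  have hG : 0 ≤ g ⬝ᵥ g := dotProduct_self_nonneg_real g
  -- corner values, as affine expressions
  have k₀₀ := h₀₀ g; have k₀₁ := h₀₁ g; have k₁₀ := h₁₀ g; have k₁₁ := h₁₁ g
  rw [expand] at k₀₀ k₀₁ k₁₀ k₁₁ ⊢
  -- step 1: free `t₁` on the two edges `s₀ = l₀` and `s₀ = u₀`
  have e₀ : 0 ≤ g ⬝ᵥ (Q₀ *ᵥ g) + g ⬝ᵥ (V₀ *ᵥ g) * l₀ - c * (g ⬝ᵥ g) + g ⬝ᵥ (V₁ *ᵥ g) * t₁ :=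
    affine_nonneg_between (by nlinarith) (by nlinarith) ht₁.1 ht₁.2
  have e₁ : 0 ≤ g ⬝ᵥ (Q₀ *ᵥ g) + g ⬝ᵥ (V₀ *ᵥ g) * u₀ - c * (g ⬝ᵥ g) + g ⬝ᵥ (V₁ *ᵥ g) * t₁ :=
    affine_nonneg_between (by nlinarith) (by nlinarith) ht₁.1 ht₁.2
  -- step 2: free `t₀`
  have e : 0 ≤ g ⬝ᵥ (Q₀ *ᵥ g) + g ⬝ᵥ (V₁ *ᵥ g) * t₁ - c * (g ⬝ᵥ g) + g ⬝ᵥ (V₀ *ᵥ g) * t₀ :=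
    affine_nonneg_between (by linarith) (by linarith) ht₀.1 ht₀.2
  linarith

/-- **PROVED — `K = 2` BOX CERTIFICATE (`ε₁`):** certified `mᵢⱼ ≤ ε₁` at the four corners give `min mᵢⱼ ≤ ε₁` on the
box; with all four margins positive, `ε₁ > 0` on the box (the two-free-prime NO-FAKE cell). [folklore] -/
theorem box2_bottomRayleigh_ge_of_corners {N : ℕ} (Q₀ V₀ V₁ : Matrix (Fin (N + 1)) (Fin (N + 1)) ℝ)
    {l₀ u₀ l₁ u₁ m₀₀ m₀₁ m₁₀ m₁₁ : ℝ} (h₀₀ : m₀₀ ≤ bottomRayleigh (Q₀ + l₀ • V₀ + l₁ • V₁))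
    (h₀₁ : m₀₁ ≤ bottomRayleigh (Q₀ + l₀ • V₀ + u₁ • V₁)) (h₁₀ : m₁₀ ≤ bottomRayleigh (Q₀ + u₀ • V₀ + l₁ • V₁))
    (h₁₁ : m₁₁ ≤ bottomRayleigh (Q₀ + u₀ • V₀ + u₁ • V₁)) {t₀ t₁ : ℝ} (ht₀ : l₀ ≤ t₀ ∧ t₀ ≤ u₀)
    (ht₁ : l₁ ≤ t₁ ∧ t₁ ≤ u₁) :
    min (min m₀₀ m₀₁) (min m₁₀ m₁₁) ≤ bottomRayleigh (Q₀ + t₀ • V₀ + t₁ • V₁) ∧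
      (0 < m₀₀ → 0 < m₀₁ → 0 < m₁₀ → 0 < m₁₁ → 0 < bottomRayleigh (Q₀ + t₀ • V₀ + t₁ • V₁)) := by
  have form : ∀ {M : Matrix (Fin (N + 1)) (Fin (N + 1)) ℝ} {b : ℝ}, b ≤ bottomRayleigh M →
      ∀ g : Fin (N + 1) → ℝ, b * (g ⬝ᵥ g) ≤ g ⬝ᵥ (M *ᵥ g) := fun hb g =>
    (mul_le_mul_of_nonneg_right hb (dotProduct_self_nonneg_real g)).trans (bottomRayleigh_mul_le_form _ g)
  have main : min (min m₀₀ m₀₁) (min m₁₀ m₁₁) ≤ bottomRayleigh (Q₀ + t₀ • V₀ + t₁ • V₁) :=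
    le_bottomRayleigh_of_form_ge _ fun g =>
      box2_form_ge_of_corners Q₀ V₀ V₁ (form h₀₀) (form h₀₁) (form h₁₀) (form h₁₁) ht₀ ht₁ g
  exact ⟨main, fun p₀₀ p₀₁ p₁₀ p₁₁ => (lt_min (lt_min p₀₀ p₀₁) (lt_min p₁₀ p₁₁)).trans_le main⟩

/-! ## §4 Positivity at the leaves suffices (no uniform margin needed in the certificate) -/

/-- PROVED: the leaf set of a cell is FINITE (a sub-box of a finite product). [folklore] -/
theorem isLeaf_finite {m : ℕ} (lin : Fin m → Bool) (l u : Fin m → ℝ) (opts : Fin m → Finset ℝ) :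
    {v : Fin m → ℝ | IsLeaf lin l u opts v}.Finite := by
  refine (Set.Finite.pi (t := fun j => if lin j then ({l j, u j} : Set ℝ) else (opts j : Set ℝ))
    fun j => ?_).subset fun w hw => ?_
  · cases lin j <;> simp
  · simp only [Set.mem_univ_pi]
    intro j
    have h := hw j
    cases hj : lin j
    · simpa [hj] using h
    · simpa [hj] using h

/-- **PROVED — NO-FAKE-CERTIFIED, verdict form:** if every cornered variable enters affinely and `ε₁ > 0` at EVERY LEAF
(each leaf certified positive by whatever certificate — ball `LDLᵀ`, subtree majorant, engine A), then `ε₁ > 0` at every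
admissible assignment. (The leaf set is finite and, given an admissible point, nonempty; take `c = min` over the leaves
and apply `cell_bottomRayleigh_pos_of_leaves`.) This is the verifier's verdict sentence "every leaf of every sector
certified `λ_min > 0`" ⇒ "no admissible completion is negative", with no uniform margin to report. [folklore] -/
theorem cell_bottomRayleigh_pos_of_leaves_pos {N m : ℕ} (F : Matrix (Fin (N + 1)) (Fin (N + 1)) ℝ)
    (W : Fin m → ℝ → Matrix (Fin (N + 1)) (Fin (N + 1)) ℝ) (lin : Fin m → Bool)
    (A B : Fin m → Matrix (Fin (N + 1)) (Fin (N + 1)) ℝ) (hW : ∀ j, lin j = true → ∀ s, W j s = A j + s • B j)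
    {l u : Fin m → ℝ} {opts : Fin m → Finset ℝ}
    (hpos : ∀ v, IsLeaf lin l u opts v → 0 < bottomRayleigh (cellMatrix F W v))
    (v : Fin m → ℝ) (hv : IsAdmissible lin l u opts v) : 0 < bottomRayleigh (cellMatrix F W v) := by
  have hne : {w : Fin m → ℝ | IsLeaf lin l u opts w}.Nonempty := by
    refine ⟨fun j => if lin j then l j else v j, fun j => ?_⟩
    have h := hv j
    cases hj : lin j
    · simpa [hj] using h
    · simp [hj]
  obtain ⟨w₀, hw₀, hmin⟩ :=
    Set.exists_min_image _ (fun w => bottomRayleigh (cellMatrix F W w)) (isLeaf_finite lin l u opts) hne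
  exact cell_bottomRayleigh_pos_of_leaves F W lin A B hW (fun w => bottomRayleigh (cellMatrix F W w)) (hpos w₀ hw₀)
    (fun w hw => hmin w hw) (fun w _ => le_rfl) v hv

/-! ## §5 The PRUNE step: a Loewner minorant of every remaining variable bounds every completion -/

/-- `L ⪯ M` as forms: `gᵀ L g ≤ gᵀ M g` for every vector (no symmetry assumed). -/
def FormLE {n : ℕ} (L M : Matrix (Fin n) (Fin n) ℝ) : Prop := ∀ g : Fin n → ℝ, g ⬝ᵥ (L *ᵥ g) ≤ g ⬝ᵥ (M *ᵥ g)

/-- PROVED: the form of `F + Σ_j M j` splits as the form of `F` plus the sum of the forms of the `M j`. [folklore] -/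
theorem form_add_sum {n m : ℕ} (F : Matrix (Fin n) (Fin n) ℝ) (M : Fin m → Matrix (Fin n) (Fin n) ℝ) (g : Fin n → ℝ) :
    g ⬝ᵥ ((F + ∑ j, M j) *ᵥ g) = g ⬝ᵥ (F *ᵥ g) + ∑ j, g ⬝ᵥ (M j *ᵥ g) := by
  rw [Matrix.add_mulVec, dotProduct_add, Matrix.sum_mulVec, dotProduct_sum]

/-- PROVED (one cornered variable): a form-minorant of the affine family `s ↦ A + s • B` at both corners `l, u` is a
form-minorant on the whole interval. [folklore] -/
theorem formLE_affine_between {n : ℕ} {L A B : Matrix (Fin n) (Fin n) ℝ} {l u s : ℝ} (hl : FormLE L (A + l • B))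
    (hu : FormLE L (A + u • B)) (hls : l ≤ s) (hsu : s ≤ u) : FormLE L (A + s • B) := by
  intro g
  have key : ∀ r : ℝ, g ⬝ᵥ ((A + r • B) *ᵥ g) - g ⬝ᵥ (L *ᵥ g)
      = (g ⬝ᵥ (A *ᵥ g) - g ⬝ᵥ (L *ᵥ g)) + g ⬝ᵥ (B *ᵥ g) * r := by
    intro r
    rw [Matrix.add_mulVec, dotProduct_add, Matrix.smul_mulVec, dotProduct_smul, smul_eq_mul]
    ring
  have h := affine_nonneg_between (α := g ⬝ᵥ (A *ᵥ g) - g ⬝ᵥ (L *ᵥ g)) (β := g ⬝ᵥ (B *ᵥ g))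
    (by rw [← key]; exact sub_nonneg.2 (hl g)) (by rw [← key]; exact sub_nonneg.2 (hu g)) hls hsu
  rw [← key] at h
  exact sub_nonneg.1 h

/-- **PROVED — THE PRUNE LEMMA (forms):** if every cornered variable enters affinely and `L j` is a form-minorant of the
`j`-th variable's contribution at every LEAF VALUE (cornered: at both corners; enumerated: at every option), then
`F + Σ_j L j ⪯ cellMatrix F W v` for every ADMISSIBLE `v`.  (JSON: the verifier's subtree bound
`P + Σ_{j ≥ i} (Cref_j − A_j)`, with the assigned prefix folded into `F` / degenerate ranges, is such an `F + Σ L`.) [folklore] -/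
theorem cell_form_ge_minorant {n m : ℕ} (F : Matrix (Fin n) (Fin n) ℝ) (W : Fin m → ℝ → Matrix (Fin n) (Fin n) ℝ)
    (lin : Fin m → Bool) (A B : Fin m → Matrix (Fin n) (Fin n) ℝ) (hW : ∀ j, lin j = true → ∀ s, W j s = A j + s • B j)
    {l u : Fin m → ℝ} {opts : Fin m → Finset ℝ} (L : Fin m → Matrix (Fin n) (Fin n) ℝ)
    (hLlin : ∀ j, lin j = true → FormLE (L j) (W j (l j)) ∧ FormLE (L j) (W j (u j)))
    (hLenum : ∀ j, lin j = false → ∀ s ∈ opts j, FormLE (L j) (W j s))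
    (v : Fin m → ℝ) (hv : IsAdmissible lin l u opts v) : FormLE (F + ∑ j, L j) (cellMatrix F W v) := by
  intro g
  have hj : ∀ j, g ⬝ᵥ (L j *ᵥ g) ≤ g ⬝ᵥ (W j (v j) *ᵥ g) := by
    intro j
    have h := hv j
    cases hlj : lin j
    · simp only [hlj] at h
      exact hLenum j hlj (v j) (by simpa using h) g
    · simp only [hlj, if_true] at h
      obtain ⟨hl, hu⟩ := hLlin j hlj
      rw [hW j hlj] at hl hu ⊢
      exact formLE_affine_between hl hu h.1 h.2 g
  unfold cellMatrix
  rw [form_add_sum, form_add_sum]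
  exact add_le_add le_rfl (Finset.sum_le_sum fun j _ => hj j)

/-- **PROVED — THE PRUNE LEMMA (`ε₁` language): `ε₁(F + Σ L j) ≤ ε₁(cellMatrix F W v)` at every admissible `v`; in
particular a certified `0 < ε₁` (or `c ≤ ε₁`) of the minorant certifies the whole subtree.** [folklore] -/
theorem cell_bottomRayleigh_ge_minorant {N m : ℕ} (F : Matrix (Fin (N + 1)) (Fin (N + 1)) ℝ)
    (W : Fin m → ℝ → Matrix (Fin (N + 1)) (Fin (N + 1)) ℝ) (lin : Fin m → Bool)
    (A B : Fin m → Matrix (Fin (N + 1)) (Fin (N + 1)) ℝ) (hW : ∀ j, lin j = true → ∀ s, W j s = A j + s • B j)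
    {l u : Fin m → ℝ} {opts : Fin m → Finset ℝ} (L : Fin m → Matrix (Fin (N + 1)) (Fin (N + 1)) ℝ)
    (hLlin : ∀ j, lin j = true → FormLE (L j) (W j (l j)) ∧ FormLE (L j) (W j (u j)))
    (hLenum : ∀ j, lin j = false → ∀ s ∈ opts j, FormLE (L j) (W j s))
    (v : Fin m → ℝ) (hv : IsAdmissible lin l u opts v) :
    bottomRayleigh (F + ∑ j, L j) ≤ bottomRayleigh (cellMatrix F W v) ∧
      (0 < bottomRayleigh (F + ∑ j, L j) → 0 < bottomRayleigh (cellMatrix F W v)) := by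
  have h : bottomRayleigh (F + ∑ j, L j) ≤ bottomRayleigh (cellMatrix F W v) :=
    le_bottomRayleigh_of_form_ge _ fun g =>
      (bottomRayleigh_mul_le_form _ g).trans (cell_form_ge_minorant F W lin A B hW L hLlin hLenum v hv g)
  exact ⟨h, fun h0 => h0.trans_le h⟩

end Summit.RiemannHypothesis.RiemannHypothesis.Theorems.PfPersistence
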